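import Summits.CriticalPhenomena.PercolationContinuityZ3.Theorems.Transplant.TiltedSectorDesign
import HarnessLib

/-!
# The far-station design at an ARBITRARY (interior) apex of the tilted sector-slab, relative to a general step graph

builds on p205010 (kernel theorem, internal audit signed; external expert review pending) — NOT used in this file.
Lane `prim-bschramm`, seat `prim-bschramm-p2` (gen 27; class C1b, METHOD = input substitution; memo `HOME/bschramm/P2-LATTICES.md` §93–§94);
helper file (`--supports stmt-CriticalPhenomena-4575 --as helper`) for ROW N3b of TABLE v41 (a.s. uniqueness of the infinite cluster in the 3D
TILTED WEDGES `{s₁x₁ ≤ x₂ ≤ s₂x₁} × ℤ`).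

THE POINT.  Gen 24's station design for the tilted sector-slab `𝕋𝕊 = {x ∈ S_k | s₁x₁ ≤ x₂ ≤ s₂x₁}` (`TiltSector.tsec_vertex_design`) serves the apexes
`b = u + e₁`, `b = u + e₂` of the inner-boundary vertices `u` of the cube `[-N,N]³`, and concludes for the exterior step graph of the cube.  In the 3D
wedge (coordinate `x₀` free) the SLICES `{c ≤ x₀ ≤ c+k}` are tilted sector-slabs, but the exits through the faces `x₀ = ±N` of the cube land at
ARBITRARY planar positions of the slice beyond the face — interior apexes — and the relevant "box to avoid" in the slice frame is not the cube.
This file re-derives the design for ANY apex `b ∈ 𝕋𝕊` at a thick level (`(s₂ - s₁) b₁ ≥ 2H`, `b₁ ≤ L ≤ Y`) and ANY step graph `K` containing the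
lattice steps inside the region `G_b = {x ∈ 𝕋𝕊 | (b₁ ≤ x₁ ∧ b₂ ≤ x₂) ∨ Y ≤ x₁}` (which contains the tilted fattened arm at `b`, the station's shallow
region and the fibre segments between them): **`far_design_at`** — on "arm reaches `{x₁ = T}`" ∩ "station arm reaches `{x₂ = Z}`" (`P ≥ α·A.α`,
Harris) at most `k` extra open edges of `[-M,M]³` join `b` to the far station `Ω = (0, Y, ⌈s₁Y⌉)` through open `K`-steps
(`TiltSector.link_move_region_far`).  The size hypotheses are those of `tsec_vertex_design` with the apex level bound `L` in place of `N + 1`.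
[cite: AizenmanChayesChayesFrohlichRusso1983, §4 Thm 4.4, Lemma 4.2 (a), Lemma 4.3] [cite: DuminilCopinSidoraviciusTassion2016, Thm. 1 and §2]
[cite: GrimmettPercolation1999, §8.3 Thm (8.8) p. 202; Thm. (2.4)] -/

noncomputable section

namespace Summit.CriticalPhenomena.PercolationContinuityZ3.Theorems.Transplant

namespace TiltWedgeUniq

open MeasureTheory Literature.Probability.Percolation Literature.Probability.LatticeModels SimpleGraph HSU OrthantUniq HalfSlabUniq
  RationalHalfSlab TiltSector Filter
open scoped Classical

variable {k : ℕ} {s₁ s₂ : ℝ}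

/-- **THE FAR-STATION DESIGN AT AN ARBITRARY APEX OF THE TILTED SECTOR-SLAB, for a general step graph.**  Data: slopes `0 < s₁ < s₂`, `s₁ ≤ 2`; arm
slopes `s₁ ≤ σ₁ ≤ σ₂ ≤ s₂`; fattening `H`; an apex `b ∈ 𝕋𝕊` at a thick level, `2H ≤ (s₂ - s₁) b₁`, with `b₁ ≤ L`; station abscissa `Y ≥ L`,
`Ω₂ = ⌈s₁Y⌉ ≤ Z = ⌊s₂Y⌋`, right end `T = Y + (Z - Ω₂)`, the fit `(s₂-σ₂)L + σ₂T + H + 1 ≤ s₂Y`; window `M ≥ k, T, s₂T`; arm bounds `α` for `b + 𝔸↑`,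
`b + 𝔸↓` and a slab arm kit `A` at `p'`; a step graph `K` containing the lattice steps inside `G_b = {x ∈ 𝕋𝕊 | (b₁ ≤ x₁ ∧ b₂ ≤ x₂) ∨ Y ≤ x₁}`.
Conclusion: an increasing measurable event determined by the edges of `[-M,M]³`, of `P_{p'} ≥ α·A.α`, on which `≤ k` extra open edges of `[-M,M]³`
join `b` to the station `Ω = (0, Y, Ω₂)` through open `K`-steps. [cite: AizenmanChayesChayesFrohlichRusso1983, §4 Cor. to Lemma 4.3, Lemma 4.2 (a)] -/
theorem far_design_at (hs : s₁ < s₂) (hs₁ : 0 < s₁) (hs2 : s₁ ≤ 2) {σ₁ σ₂ : ℝ} (hσ₁ : s₁ ≤ σ₁) (hσ : σ₁ ≤ σ₂) (hσ₂ : σ₂ ≤ s₂)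
    {H : ℕ} {b : Site 3} (hbD : b ∈ {x : Site 3 | x ∈ slab 3 k ∧ (s₁ * (x 1 : ℝ) ≤ (x 2 : ℝ) ∧ (x 2 : ℝ) ≤ s₂ * (x 1 : ℝ))})
    (hbH : 2 * (H : ℝ) ≤ (s₂ - s₁) * (b 1 : ℝ)) {L : ℤ} (hbL : b 1 ≤ L)
    {Y Ω₂ Z T : ℤ} (hY : L ≤ Y) (hΩ₂ : Ω₂ = ⌈s₁ * (Y : ℝ)⌉) (hZ : Z = ⌊s₂ * (Y : ℝ)⌋) (hΩZ : Ω₂ ≤ Z) (hT : T = Y + (Z - Ω₂))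
    (hfit : (s₂ - σ₂) * (L : ℝ) + σ₂ * (T : ℝ) + H + 1 ≤ s₂ * (Y : ℝ))
    {M : ℕ} (hMk : k ≤ M) (hMT : T ≤ (M : ℤ)) (hMs : s₂ * (T : ℝ) ≤ M)
    {p' : unitInterval} (A : SlabArmKit k p') {α : ℝ} (hα : 0 < α)
    (harmU : α ≤ (bondPercolation (zdGraph 3) p').real (percolatesVia (withinGraph (zdGraph 3) (armUpAt k σ₁ σ₂ H b)) b))
    (harmD : α ≤ (bondPercolation (zdGraph 3) p').real (percolatesVia (withinGraph (zdGraph 3) (armDnAt k σ₁ σ₂ H b)) b))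
    {K : SimpleGraph (Site 3)}
    (hK : withinGraph (zdGraph 3) {x : Site 3 | x ∈ {x : Site 3 | x ∈ slab 3 k ∧ (s₁ * (x 1 : ℝ) ≤ (x 2 : ℝ) ∧ (x 2 : ℝ) ≤ s₂ * (x 1 : ℝ))} ∧
      ((b 1 ≤ x 1 ∧ b 2 ≤ x 2) ∨ Y ≤ x 1)} ≤ K) :
    ∃ E : Set (BondConfig (Site 3)), IsUpperSet E ∧ MeasurableSet E ∧ DeterminedBy E ↑(edgesIn (zdGraph 3) (box 3 M)) ∧
      α * A.α ≤ (bondPercolation (zdGraph 3) p').real E ∧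
      ∀ ω ∈ E, ∃ F : Finset (Sym2 (Site 3)), F ⊆ edgesIn (zdGraph 3) (box 3 M) ∧ F.card ≤ k ∧ ω ∪ ↑F ∈ openConnVia K b ![0, Y, Ω₂] := by
  have hs₂ : 0 < s₂ := hs₁.trans hs
  have hσ0 : 0 ≤ σ₁ := hs₁.le.trans hσ₁
  have hσ20 : 0 ≤ σ₂ := hσ0.trans hσ
  have hH0 : (0 : ℝ) ≤ H := by positivity
  have hΩ₂lo : s₁ * (Y : ℝ) ≤ (Ω₂ : ℝ) := by rw [hΩ₂]; exact Int.le_ceil _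
  have hZhi : (Z : ℝ) ≤ s₂ * (Y : ℝ) := by rw [hZ]; exact Int.floor_le _
  have hΩZr : (Ω₂ : ℝ) ≤ (Z : ℝ) := by exact_mod_cast hΩZ
  have hYT : Y ≤ T := by rw [hT]; linarith
  have hYTr : (Y : ℝ) ≤ (T : ℝ) := by exact_mod_cast hYT
  set D : Set (Site 3) := {x : Site 3 | x ∈ slab 3 k ∧ (s₁ * (x 1 : ℝ) ≤ (x 2 : ℝ) ∧ (x 2 : ℝ) ≤ s₂ * (x 1 : ℝ))} with hD
  obtain ⟨hbslab, hblo, hbhi⟩ := hbD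
  obtain ⟨hb1nn, hb2nn⟩ := nonneg_of_mem_tsec hs hs₁ (show b ∈ D from ⟨hbslab, hblo, hbhi⟩)
  have hbLr : (b 1 : ℝ) ≤ (L : ℝ) := by exact_mod_cast hbL
  have hLY : (L : ℝ) ≤ (Y : ℝ) := by exact_mod_cast hY
  have hb1r : (0 : ℝ) ≤ (b 1 : ℝ) := by exact_mod_cast hb1nn
  have hY0 : (0 : ℝ) ≤ (Y : ℝ) := by linarith
  have hΩ₂0 : (0 : ℝ) ≤ Ω₂ := le_trans (mul_nonneg hs₁.le hY0) hΩ₂lo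
  have hbT : b 1 ≤ T := by linarith
  set Ω : Site 3 := ![0, Y, Ω₂] with hΩ_def
  have hΩ0 : Ω 0 = 0 := by simp [hΩ_def]
  have hΩ1 : Ω 1 = Y := by simp [hΩ_def]
  have hΩ2' : Ω 2 = Ω₂ := by simp [hΩ_def]
  have hΩslab : Ω ∈ slab 3 k := by show 0 ≤ Ω 0 ∧ Ω 0 ≤ (k : ℤ); rw [hΩ0]; exact ⟨le_rfl, by positivity⟩
  -- window: every point of `D` below `{x₁ ≤ T}` lies in `[-M, M]³`
  have win : ∀ x ∈ D, x 1 ≤ T → ∀ j, |x j| ≤ (M : ℤ) := by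
    intro x hx hxT j
    obtain ⟨hx1, hx2⟩ := nonneg_of_mem_tsec hs hs₁ hx
    obtain ⟨⟨h00, h0k⟩, -, hup⟩ := hx
    have hxTr : (x 1 : ℝ) ≤ (T : ℝ) := by exact_mod_cast hxT
    have e1 : s₂ * (x 1 : ℝ) ≤ s₂ * (T : ℝ) := mul_le_mul_of_nonneg_left hxTr hs₂.le
    have hx2M : (x 2 : ℝ) ≤ M := by linarith
    have hx2M' : x 2 ≤ (M : ℤ) := by exact_mod_cast hx2M
    have hkM : (k : ℤ) ≤ M := by exact_mod_cast hMk
    fin_cases j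
    · rw [abs_le]; constructor <;> simp <;> omega
    · rw [abs_le]; constructor <;> simp <;> omega
    · rw [abs_le]; constructor <;> simp <;> omega
  -- the station's shallow region: in `D`, beyond `Y`, below `{x₁ ≤ T}`
  have hHreg : ∀ x ∈ shallowReg k Ω Z, x ∈ D ∧ Y ≤ x 1 ∧ x 1 ≤ T := by
    intro x hx
    obtain ⟨h0, h1, h2, h3, h4⟩ := shallowReg_props hx
    rw [hΩ1] at h1 h2; rw [hΩ2'] at h2 h3
    have h1r : (Y : ℝ) ≤ (x 1 : ℝ) := by exact_mod_cast h1
    have h2r : 2 * ((x 1 : ℝ) - Y) ≤ (x 2 : ℝ) - Ω₂ := by exact_mod_cast h2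
    have h4r : (x 2 : ℝ) ≤ (Z : ℝ) := by exact_mod_cast h4
    have e1 : s₁ * ((x 1 : ℝ) - Y) ≤ 2 * ((x 1 : ℝ) - Y) := mul_le_mul_of_nonneg_right hs2 (by linarith)
    have e2 : s₂ * (Y : ℝ) ≤ s₂ * (x 1 : ℝ) := mul_le_mul_of_nonneg_left h1r hs₂.le
    exact ⟨⟨h0, by linarith, by linarith⟩, h1, by omega⟩
  have hwinH : ∀ x ∈ shallowReg k Ω Z, ∀ j, |x j| ≤ (M : ℤ) := fun x hx => win x (hHreg x hx).1 (hHreg x hx).2.2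
  -- the strip bound above: `(s₂ - σ₂) b₁ + σ₂ T + H ≤ s₂ Y - 1`, hence `≤ Z` after flooring
  have hstrip : ∀ (x : Site 3), b 1 ≤ x 1 → x 1 ≤ T → ((x 2 : ℝ) - b 2) ≤ σ₂ * ((x 1 : ℝ) - b 1) + H → x 2 ≤ Z := by
    intro x hx1 hxT hx2
    have hx1r : (b 1 : ℝ) ≤ (x 1 : ℝ) := by exact_mod_cast hx1
    have hxTr : (x 1 : ℝ) ≤ (T : ℝ) := by exact_mod_cast hxT
    have e1 : σ₂ * ((x 1 : ℝ) - b 1) ≤ σ₂ * ((T : ℝ) - b 1) := mul_le_mul_of_nonneg_left (by linarith) hσ20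
    have e2 : (s₂ - σ₂) * (b 1 : ℝ) ≤ (s₂ - σ₂) * (L : ℝ) := mul_le_mul_of_nonneg_left hbLr (by linarith)
    have : (x 2 : ℝ) ≤ s₂ * (Y : ℝ) := by linarith
    rw [hZ]; exact Int.le_floor.2 this
  -- the strip bound below: points of `D` beyond `Y` are above `Ω₂ = ⌈s₁ Y⌉`
  have hlowstrip : ∀ x ∈ D, Y ≤ x 1 → Ω₂ ≤ x 2 := by
    intro x hx hx1
    have hx1r : (Y : ℝ) ≤ (x 1 : ℝ) := by exact_mod_cast hx1
    have : s₁ * (Y : ℝ) ≤ (x 2 : ℝ) := le_trans (mul_le_mul_of_nonneg_left hx1r hs₁.le) hx.2.1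
    rw [hΩ₂]; exact Int.ceil_le.2 this
  -- generic packaging: a steep region `S ∋ b` in the slab, inside `G_b`, below `T`, in the strip beyond `Y`, with the arm bound `α`
  have pack : ∀ (S : Set (Site 3)) (_ : S ⊆ slab 3 k) (_ : b ∈ S)
      (_ : ∀ x ∈ S, x ∈ D ∧ (b 1 ≤ x 1 ∧ b 2 ≤ x 2) ∧ x 1 ≤ T ∧ (Ω 1 ≤ x 1 → Ω 2 ≤ x 2 ∧ x 2 ≤ Z))
      (_ : α ≤ (bondPercolation (zdGraph 3) p').real (reachEvent (withinGraph (zdGraph 3) S) b {x | x 1 = T})),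
      ∃ E : Set (BondConfig (Site 3)), IsUpperSet E ∧ MeasurableSet E ∧ DeterminedBy E ↑(edgesIn (zdGraph 3) (box 3 M)) ∧
        α * A.α ≤ (bondPercolation (zdGraph 3) p').real E ∧
        ∀ ω ∈ E, ∃ F : Finset (Sym2 (Site 3)), F ⊆ edgesIn (zdGraph 3) (box 3 M) ∧ F.card ≤ k ∧ ω ∪ ↑F ∈ openConnVia K b Ω := by
    intro S hSslab hbS hS hprobS
    have hM : ∀ x ∈ S ∪ shallowReg k Ω Z, ∀ j, |x j| ≤ (M : ℤ) := by
      rintro x (hx | hx) j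
      · exact win x (hS x hx).1 (hS x hx).2.2.1 j
      · exact hwinH x hx j
    have hprobH : A.α ≤ (bondPercolation (zdGraph 3) p').real
        (reachEvent (withinGraph (zdGraph 3) (shallowReg k Ω Z)) Ω {x | x 2 = Z}) :=
      le_real_of_subset (percolatesVia_subset_reachEvent_le (self_mem_shallowSet hΩslab) 2 (by rw [hΩ2']; exact hΩZ)
        (by simpa only [HalfSlabUniq.shallowReg] using shallowReg_finite (k := k) Ω Z)) (A.shallow_arm Ω hΩslab)
    set E : Set (BondConfig (Site 3)) := reachEvent (withinGraph (zdGraph 3) S) b {x | x 1 = T} ∩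
      reachEvent (withinGraph (zdGraph 3) (shallowReg k Ω Z)) Ω {x | x 2 = Z} with hE
    refine ⟨E, (isUpperSet_reachEvent _ _ _).inter (isUpperSet_reachEvent _ _ _),
      (measurableSet_reachEvent _ _ _).inter (measurableSet_reachEvent _ _ _), ?_, ?_, fun ω hω => ?_⟩
    · exact ((determinedBy_reachEvent _ _ _).mono (edgeSet_withinGraph_subset_edgesIn (subset_boxSet_of_abs_le fun x hx =>
        hM x (Or.inl hx)))).inter ((determinedBy_reachEvent _ _ _).mono (edgeSet_withinGraph_subset_edgesIn
          (subset_boxSet_of_abs_le fun x hx => hM x (Or.inr hx))))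
    · exact harris2_of_le p' (isUpperSet_reachEvent _ _ _) (isUpperSet_reachEvent _ _ _) (measurableSet_reachEvent _ _ _)
        (measurableSet_reachEvent _ _ _) hα.le hprobS hprobH
    · -- the far-station link, with the steps inside `G_b`
      have hKG : ∀ (R : Set (Site 3)), (∀ x ∈ R, x ∈ D ∧ ((b 1 ≤ x 1 ∧ b 2 ≤ x 2) ∨ Y ≤ x 1)) → withinGraph (zdGraph 3) R ≤ K :=
        fun R hR => le_trans (withinGraph_mono (zdGraph 3) fun x hx => hR x hx) hK
      refine link_move_region_far hSslab hbS (fun x hx => (hS x hx).2.2.1)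
        (fun x hx h1 => by rw [hΩ1] at h1; have := (hS x hx).2.2.2 (by rw [hΩ1]; exact h1); rwa [hΩ2'] at this) hΩslab
        (by rw [hΩ2']; exact hΩZ) (by rw [hΩ1]; omega) (fun x hx => (hHreg x hx).2.2)
        (hKG S fun x hx => ⟨(hS x hx).1, Or.inl (hS x hx).2.1⟩)
        (hKG _ fun x hx => ⟨(hHreg x hx).1, Or.inr (hHreg x hx).2.1⟩) (fun s hs t ht h1 h2 => hKG _ fun z hz => ?_) hM hω
      -- the fibre segment between `s` and `t`: same `(x₁, x₂)` as `t`, thin coordinate between `s₀` and `t₀`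
      obtain ⟨htD, htY, -⟩ := hHreg t ht
      have hz1 : z 1 = s 1 := eq_of_mem_bbox hz h1
      have hz2 : z 2 = s 2 := eq_of_mem_bbox hz h2
      have hs0 := hSslab hs
      have ht0 := (shallowReg_props ht).1
      have hz0' := hz 0
      have hzslab : z ∈ slab 3 k := ⟨le_trans (le_min hs0.1 ht0.1) hz0'.1, le_trans hz0'.2 (max_le hs0.2 ht0.2)⟩
      refine ⟨tsec_cyl t htD z hzslab (by rw [hz1, h1]) (by rw [hz2, h2]), Or.inr (by rw [hz1, h1]; exact htY)⟩
  by_cases hlow : (H : ℝ) ≤ (b 2 : ℝ) - s₁ * (b 1 : ℝ)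
  · -- DOWNWARD-fattened arm `b + 𝔸↓`
    set S : Set (Site 3) := armDnAt k σ₁ σ₂ H b ∩ {x | x 1 ≤ T} with hS_def
    have hbS : b ∈ S := ⟨self_mem_armDnAt hbslab, hbT⟩
    have hSprops : ∀ x ∈ S, x ∈ D ∧ (b 1 ≤ x 1 ∧ b 2 ≤ x 2) ∧ x 1 ≤ T ∧ (Ω 1 ≤ x 1 → Ω 2 ≤ x 2 ∧ x 2 ≤ Z) := by
      rintro x ⟨hxA, hxT⟩
      have hxT' : x 1 ≤ T := hxT
      obtain ⟨hx0, ht1, ht2, hlo', hhi'⟩ := mem_armDnAt_iff.1 hxA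
      have ht1r : (0 : ℝ) ≤ ((x 1 - b 1 : ℤ) : ℝ) := by exact_mod_cast ht1
      push_cast at hlo' hhi' ht1r
      have e1 : s₁ * ((x 1 : ℝ) - b 1) ≤ σ₁ * ((x 1 : ℝ) - b 1) := mul_le_mul_of_nonneg_right hσ₁ ht1r
      have e2 : σ₂ * ((x 1 : ℝ) - b 1) ≤ s₂ * ((x 1 : ℝ) - b 1) := mul_le_mul_of_nonneg_right hσ₂ ht1r
      have hxD : x ∈ D := ⟨hx0, by linarith, by linarith⟩
      refine ⟨hxD, ⟨by omega, by omega⟩, hxT', fun hx1 => ⟨?_, ?_⟩⟩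
      · rw [hΩ2']; rw [hΩ1] at hx1; exact hlowstrip x hxD hx1
      · exact hstrip x (by omega) hxT' (by linarith)
    have hSfin : S.Finite := (boxSet_finite _).subset (subset_boxSet_of_abs_le fun x hx =>
      win x (hSprops x hx).1 (hSprops x hx).2.2.1)
    have hprobS : α ≤ (bondPercolation (zdGraph 3) p').real (reachEvent (withinGraph (zdGraph 3) S) b {x | x 1 = T}) :=
      le_real_of_subset (percolatesVia_subset_reachEvent_le (self_mem_armDnAt hbslab) 1 hbT (by simpa [hS_def] using hSfin)) harmD
    exact pack S (fun x hx => armDnAt_subset_slab b hx.1) hbS hSprops hprobS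
  · -- UPWARD-fattened arm `b + 𝔸↑` (`b` is at least `H` below the upper edge)
    push Not at hlow
    have hup : (H : ℝ) ≤ s₂ * (b 1 : ℝ) - (b 2 : ℝ) := by linarith
    set S : Set (Site 3) := armUpAt k σ₁ σ₂ H b ∩ {x | x 1 ≤ T} with hS_def
    have hbS : b ∈ S := ⟨self_mem_armUpAt hbslab, hbT⟩
    have hSprops : ∀ x ∈ S, x ∈ D ∧ (b 1 ≤ x 1 ∧ b 2 ≤ x 2) ∧ x 1 ≤ T ∧ (Ω 1 ≤ x 1 → Ω 2 ≤ x 2 ∧ x 2 ≤ Z) := by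
      rintro x ⟨hxA, hxT⟩
      have hxT' : x 1 ≤ T := hxT
      obtain ⟨hx0, ht1, hlo', hhi'⟩ := mem_armUpAt_iff.1 hxA
      have ht1r : (0 : ℝ) ≤ ((x 1 - b 1 : ℤ) : ℝ) := by exact_mod_cast ht1
      push_cast at hlo' hhi' ht1r
      have e1 : s₁ * ((x 1 : ℝ) - b 1) ≤ σ₁ * ((x 1 : ℝ) - b 1) := mul_le_mul_of_nonneg_right hσ₁ ht1r
      have e2 : σ₂ * ((x 1 : ℝ) - b 1) ≤ s₂ * ((x 1 : ℝ) - b 1) := mul_le_mul_of_nonneg_right hσ₂ ht1r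
      have e3 : 0 ≤ σ₁ * ((x 1 : ℝ) - b 1) := mul_nonneg hσ0 ht1r
      have hxD : x ∈ D := ⟨hx0, by linarith, by linarith⟩
      have hx2b : b 2 ≤ x 2 := by
        have : (b 2 : ℝ) ≤ (x 2 : ℝ) := by linarith
        exact_mod_cast this
      refine ⟨hxD, ⟨by omega, hx2b⟩, hxT', fun hx1 => ⟨?_, ?_⟩⟩
      · rw [hΩ2']; rw [hΩ1] at hx1; exact hlowstrip x hxD hx1
      · exact hstrip x (by omega) hxT' (by linarith)
    have hSfin : S.Finite := (boxSet_finite _).subset (subset_boxSet_of_abs_le fun x hx =>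
      win x (hSprops x hx).1 (hSprops x hx).2.2.1)
    have hprobS : α ≤ (bondPercolation (zdGraph 3) p').real (reachEvent (withinGraph (zdGraph 3) S) b {x | x 1 = T}) :=
      le_real_of_subset (percolatesVia_subset_reachEvent_le (self_mem_armUpAt hbslab) 1 hbT (by simpa [hS_def] using hSfin)) harmU
    exact pack S (fun x hx => armUpAt_subset_slab b hx.1) hbS hSprops hprobS

end TiltWedgeUniq

end Summit.CriticalPhenomena.PercolationContinuityZ3.Theorems.Transplant

end
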